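import Mathlib
import HarnessLib
import HarnessLib.Audit
import Summits.KontsevichZagierPeriods.Statement
import Literature.NumberTheory.Transcendental.KZCalculus
import Literature.NumberTheory.EllipticCurves.RealLatticePeriod
import Literature.NumberTheory.EllipticCurves.RealLatticePeriodDiscrProofs
import HarnessLib.Audit.Status.Attr

/-!
Route: LatticeLefschetz

DORMANT since 2026-08-25T03:34:02Z (reconciler: no traction for 7.3 d (last activity item-evidence-added at 2026-08-17T18:57:06Z); parked, not closed — `ledger route dormant route-KontsevichZagierPeriods-LatticeLefschetz --off` to react) — unstaffed, not closed; items shared with open routes are served there. `ledger route dormant <id> --off` reactivates.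

# Route LatticeLefschetz — integrality is the transcendence — twisted squares of real elliptic
periods are complete by lattice rigidity, certified by the uniformised-branch transfer from a
lattice inclusion

INTEGRALITY IS THE TRANSCENDENCE. The H21 calculus is ℤ-linear, so Conjecture 1 only ever needs
ℤ-relations among periods; on a p_g = 1
real surface a ℤ-relation among periods of the holomorphic 2-form over conjugation-(anti)invariant
INTEGRAL cycles is a Hodge condition on an
integral class, hence a Néron–Severi class (Lefschetz (1,1)) — no transcendence theorem enters. It
suffices to show X = ENGINE ∧ OffCellKernel, where ENGINE = TwistPeriodLattices ∧
ProductValues ∧ LatticeRigidity ∧ TwistTransfer ∧ ProductBookkeeping is KERNEL-CHECKED (inside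
`closes`, and as the planner's skeleton
bc/TwistedSquaresCell_birth.lean) to give the TWISTED-SQUARES CELL (the first cell, the abelian
surface E × E′ of two real elliptic curves y² = x³+Ax+B, y² = x³+A′x+B′ over ℤ
with three real roots each; E⁻ : y² = x³+Ax−B is the twist by −1, whose real period is the imaginary
period of E): if a·Ω(E)Ω(E′) =
b·Ω(E⁻)Ω(E′⁻) with a, b positive rationals — the two numbers being the values of the two
2-dimensional product representations of the
cell — then the two representations are KZ-equivalent. OffCellKernel is the declared, NOT-claimed
remainder (kernel conjecture of the
calculus enlarged by the cell's relators). Realises the reality face of card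
hodge-subfamily-hermitian-squares (absorbed card
rank-one-hodge-real-periods); the K3 row (real sextic double planes) is filed as an informal crux
after open.
Lean:
`(Summit.KontsevichZagierPeriods.KontsevichZagierPeriods.Theses.LatticeLefschetz.TwistPeriodLattices
∧ Summit.KontsevichZagierPeriods.KontsevichZagierPeriods.Theses.LatticeLefschetz.ProductValues ∧
Summit.KontsevichZagierPeriods.KontsevichZagierPeriods.Theses.LatticeLefschetz.LatticeRigidity ∧
Summit.KontsevichZagierPeriods.KontsevichZagierPeriods.Theses.LatticeLefschetz.TwistTransfer ∧
Summit.KontsevichZagierPeriods.KontsevichZagierPeriods.Theses.LatticeLefschetz.ProductBookkeeping) ∧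
Summit.KontsevichZagierPeriods.KontsevichZagierPeriods.Theses.LatticeLefschetz.OffCellKernel`

## Assembly
Deciding theorem `closes : TwistPeriodLattices → ProductValues → LatticeRigidity → TwistTransfer →
ProductBookkeeping → OffCellKernel →
KontsevichZagierPeriods` (glue.lean, ≈ 125 lines, certified: every item is a load-bearing binder).
Inside, the TWISTED-SQUARES CELL is derived as
a `have` by a real proof (identical to the planner's skeleton bc/TwistedSquaresCell_birth.lean
`TwistedSquaresCell_of`, rc 0): the values give
a·Ω₀Ω₀′ = b·Ω₁Ω₁′ (linear_combination), LatticeRigidity gives μ, TwistTransfer applied to (E⁻,E′)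
and to (E,E′⁻) (tree lemmas
`PeriodPair.IsReal.mulLeft_I`, `g₂_mulLeft_I`, `g₃_mulLeft_I`) gives k₁, k₂, algebraicity of μ and
two 1-dim equivalences, the identity
a·k₂ = b·k₁ makes the two scalings aμ/k₁ = bμ/k₂ equal, ProductBookkeeping closes the cell; then the
kernel step: `KZ.eval_of`, `sup_le`,
`AddSubgroup.closure_le`, each adjoined relator discharged by the cell. The cell statement itself
(for the ledger, as the headline theorem
provers land in Theorems/): ∀ A B A′ B′ ∈ ℤ with 4A³+27B² < 0, 4A′³+27B′² < 0, ∀ positive rationals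
a b, the representations
[{x³+Ax+B>0}×{y³+A′y+B′>0}, a/√(PP′)] and [{x³+Ax−B>0}×{y³+A′y−B′>0}, b/√(P⁻P′⁻)] with equal values
are KZ-equivalent.

Rationale: WHY THIS LINE. Mechanism: a·Ω(E)Ω(E′) = b·Ω(E⁻)Ω(E′⁻) says t·t′ = a/b for the period ratios τ = it,
τ′ = it′ of the two RECTANGULAR real lattices (disc > 0;
Lawden1989 Ch. 6, tree `Literature/NumberTheory/EllipticCurves/RealLatticePeriod*`), i.e. τ′ =
−(m/n)/τ is an INTEGRAL Möbius image of τ: the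
lattices Λ(E⁻) = iΛ(E) and Λ(E′) are commensurable after a real homothety μ, by pure lattice algebra
(support LatticeRigidity) — this is
Lefschetz (1,1) on E × E′ (NS = ℤ² ⊕ Hom(E,E′)) read on c-invariant integral 2-cycles, and it is
exactly the input that route
IsogenyCertificates obtains from Schneider 1937 / Huber–Wüstholz for LINEAR relations
(Theorems/IsogenyCertificatesRealPeriodSectorComplete,
`stub_realLatticeCommensurable`); products of 1-periods are outside every analytic-subgroup theorem
(HuberWustholz2022 Rem. 13.2 (3)) and
GPC(E×E′) is open (Chudnovsky1984 gives trdeg 2 for ONE CM curve only). The certificate is the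
tree's uniformised-branch transfer
Φ = ℘_Λ′∘(μ·)∘℘_Λ⁻¹ (crux TwistTransfer: one rule-2 move per monotone piece, the graph on a
divided-isogeny curve over a REAL NUMBER FIELD since
μ is algebraic irrational in general — j = 8000: μ ∈ ℚ(√2)), the irrational multipliers cancelling
formally between the two mixed products
(support ProductBookkeeping). Imported: Hodge theory of real abelian surfaces (Lefschetz (1,1);
SilvermanAEC2009 VI.4–VI.5), real elliptic
function theory (Lawden1989), the KZ product ideal (KZProductIdeal). What no route does:
IsogenyCertificates / AbelContraction /
HermiteRigidity certify LINEAR real 1-period cells with transcendence (Baker–Wüstholz, Schneider,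
HW) as completeness input; Grothendieck uses
Chudnovsky for the lemniscatic quadratic sector; CyclesAsDomains and MotivatedMoves run cycles
FORWARD (given a cycle, a chain) with
conjecture-strength completeness; here completeness of a WEIGHT-2 (bilinear) sector is a theorem of
integrality alone. Negatives index:
KinematicPlaneConvex (convexity) unrelated.

RANKED CRUXES. #2 TwistTransfer (crux) — TWIST TRANSFER — for two real period lattices Λ₁, Λ₂ of
cubics x³+Aᵢx+Bᵢ (three real roots) and a real μ > 0 with μΛ₁ ⊆ Λ₂: μΩ₀(Λ₁) = kΩ₀(Λ₂) for a positive
integer k, μ is algebraic, and for every positive rational q the representations [{P₁>0},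
(qμ/k)/√P₁] and [{P₂>0}, q/√P₂] are KZ-equivalent (the uniformised-branch transfer of
IsogenyCertificates with a LATTICE INCLUSION as hypothesis instead of Schneider, and an algebraic —
not rational — scaling). [difficulty: L] (why it might fail: the divided-isogeny curve carrying Φ =
℘₂∘(μ·)∘℘₁⁻¹ has coefficients in a real number field (μ ∉ ℚ: ℚ(√2) at j = 8000): branch
semialgebraicity, finite fibres and the k-piece dissection at real division points must be redone
over ℝ_alg; a piece image missing more than a null set breaks rule 2.) [SilvermanAEC2009,
Lawden1989, KontsevichZagier2001,
Summit.KontsevichZagierPeriods.IsogenyCertificates.RealPeriodSectorCompleteLine.RealPeriodSectorComplete_of]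
#3 OffCellKernel (crux) — DECLARED REMAINDER, NOT CLAIMED easier than the Statement: Conjecture 1 in
kernel form for the calculus enlarged by the twisted-squares relators (every value-0 formal
ℤ-combination lies in KZ.relations ⊔ closure of the cell's pair differences). Summit-implied;
equivalent to the kernel conjecture modulo the cell. [deps: TwistTransfer] [difficulty:
open-problem] (why it might fail: it is Conjecture 1 off the cell (GPC-strength: the barriers
kzConjecture_implies_* bite here and only here); false iff Conjecture 1 fails (route Neg's bets).)
[KontsevichZagier2001, HuberMullerStachPeriods2017, Ayoub2014]
#9 LatticeRigidity (support) — LATTICE RIGIDITY (the transcendence-free completeness input): for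
real lattices Λ, Λ′ with g₂³ − 27g₃² > 0 (rectangular), a·Ω₀(Λ)Ω₀(Λ′) = b·Ω₀(iΛ)Ω₀(iΛ′) with a, b
positive rationals forces a real μ > 0 with μ·iΛ ⊆ Λ′ and μ·Λ ⊆ iΛ′ (τ′ = −(m/n)/τ; μ =
nΩ₀(iΛ′)/Ω₀(Λ)). [difficulty: provable-now] [Lawden1989, SilvermanAEC2009]
#9 TwistPeriodLattices (support) — the real period lattice of y² = x³+Ax+B (4A³+27B² < 0): a real
PeriodPair with g₂ = −4A, g₃ = −4B and positive discriminant, and existence of the 1-dim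
representations [{P>0}, c/√P], [{P⁻>0}, c/√P⁻] for real-algebraic c > 0 (tree: Uniformization,
RealLatticePeriod, IsogenyCertificates rep constructions). [difficulty: provable-now] [Lawden1989,
SilvermanAEC2009]
#9 ProductValues (support) — Fubini + the real-period formula: a product representation of the cell
has value a·(2Ω₀)(2Ω₀′) (tree `IntegralRep.value_prod`, `IsReal.realPeriod_formula_holds`).
[difficulty: provable-now] [Lawden1989, KontsevichZagier2001]
#9 ProductBookkeeping (support) — calculus algebra: a product representation equals the Fubini
product of its factors, `Equivalent.prod` and the factor swap `mul_sub_mul_comm_mem_relations` turn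
two 1-dim equivalences with ONE common scaling into the cell's equivalence (tree KZProductIdeal).
[difficulty: provable-now] [KontsevichZagier2001]

TWO-LAYER PLAN. TwistTransfer ⇐ IsogenyBranch → PiecewiseBranchMove → UnboundedReductionAlg →
TwistTransfer (the planner's registered skeleton
bc/TwistTransfer_birth.lean, rc 0: uniformised branch cut at the k−1 real division points +
algebraicity of μ; k rule-2 moves; reduction to
the unbounded oval with algebraic scaling) — filed as a split only if the crux stalls. Second cell
foreseen (informal crux RealDoublePlaneCell,
filed after open): for a real K3 double plane w² = F(x,y) (F ∈ ℚ[x,y] a smooth sextic) the oval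
periods ∬_{Dᵢ} dxdy/√F over the bounded
components Dᵢ of {F>0} are periods of ω over c-invariant integral 2-cycles, so every ℤ-relation
among them is a Néron–Severi class (Lefschetz
(1,1); for Picard rank 1 there is none — an unconditional independence theorem) and the chain is
cycles-as-domains on X(ℂ); OffCellKernel is
then re-glued with both relator families.

KILL CRITERIA. A refutation of the cell (a pair (E,E′,a,b) with equal values and provably
inequivalent representations) refutes Conjecture 1 itself
(route Neg wins) — close refuted:OffCellKernel. A refutation of TwistTransfer AS TYPED (e.g. the
k-piece images miss more than a
null set, or the algebraic-scaling representations do not exist) forces a restatement, not a pivot.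
If IsogenyCertificates'
AlgebraicModuliRealPeriodCell closes with a transfer over real-algebraic moduli, TwistTransfer
becomes a corollary (moot, good). LatticeRigidity
false as typed ⇒ the rectangular-lattice convention is wrong ⇒ restate with the index-2 correction.

NOT DECOMPOSED YET. The K3 / genus-2 rows (they need cycles-as-domains on a real 4-manifold and
Abel–Jacobi for Jacobians — no algebraic-geometry library);
effectivity (chain length ≤ C·(a.num·b.den + …), the isogeny degree being mn); the mixed four-term
relations among {Ω(E)Ω(E′), Ω(E)Ω(E′⁻),
Ω(E⁻)Ω(E′), Ω(E⁻)Ω(E′⁻)}, which are Gaussian-integer Möbius relations τ′ = g·τ, g ∈ GL₂(ℤ[i]) and DO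
need transcendence (they are where
GPC(E×E′) lives) — deliberately outside the cell.

CHEAPEST FALSIFIER. Numerics of the calibration instance: E : y² = x³ − 30x + 56 (j = 8000, CM by
√−2), E⁻ : y² = x³ − 30x − 56; the cell predicts
Ω(E)² = 2·Ω(E⁻)² (t = 1/√2). Run locally (Simpson, 2·10⁴ nodes): unbounded half-periods 1.4543032
and 1.0283477, bounded = unbounded on both
curves, ratio² = 2.0000000023 — PASSED. A refuter's LLL on {Ω(Eᵢ)Ω(Eⱼ^±)} for non-isogenous pairs
(11a1, 37a1, …) must find no 2-term integer
relation of twist-pair shape with tt′ ∉ ℚ (Lefschetz), and for CM / isogenous pairs exactly the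
predicted ones.

NUMBERS. j = 8000: (A,B) = (−30, 56), t² = 1/2; j = 1728: (A,B) = (−1,0), t = 1 (E⁻ = E, trivial
instance); class-number-one CM j's with disc > 0
models give the diagonal instances n·Ω(E)² = m·Ω(E⁻)² (card hodge-subfamily P4 lists the five
possible {n,m}).

DEFINITION REQUESTS. None: PeriodPair (Mathlib), PeriodPair.IsReal / mulLeft / minRealPeriod
(Literature/NumberTheory/EllipticCurves/Uniformization,
RealLatticePeriod), KZ.IntegralRep / Equivalent / relations / eval (KZCalculus) all exist.

Novelty: Searches (2026-08-17): `lit search --source arxiv` "quadratic relations periods elliptic curves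
isogeny twist" (0), "products of elliptic periods linear independence" (0), "Kontsevich Zagier
conjecture elliptic curves real period" (0), "period conjecture abelian surface product elliptic
curves Lefschetz" (0), "Grothendieck period conjecture product of elliptic curves" (0),
"transcendence products of periods of elliptic curves" (0), "Legendre relation quadratic twist
periods" (0); `lit search --source crossref` "Gao Ullmo quadratic relations holomorphic periods" (5:
doi:10.1017/s1474748025101291 = arXiv:2411.12249 read p. 1, doi:10.4171/dm/1061,
doi:10.2748/tmj.20211209); `lit galaxy search --star all` "periods of elliptic curves quadratic
relations" (0), `--star pdf` "Grothendieck period conjecture" (5; the Gao–Ullmo hit); `lit search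
--source arxiv "Kontsevich Zagier conjecture"` (14, all known or held); `lit frontier
KontsevichZagierPeriods --since 2023` (30 rows; arXiv:2106.03803 Hörmann read in full,
arXiv:2303.05030 GPC for Kummer surfaces); hub: all 92 Theses headers, 30 open + 131 closed cards,
`ledger negatives`.
Nearest prior art found: arXiv:2411.12249 (Gao–Ullmo: Hodge relations among holomorphic periods of
CM abelian varieties A×B are generated by explicit monomial QUADRATIC ones — value level, CM,
ℚ̄-coefficients); hub card hodge-subfamily-hermitian-squares / rank-one-hodge-real-periods (the
reality face, graded new-combination, unrouted: this route realises it)  [refs: 10.1017/s1474748025101291, 10.4171/dm/1061, 10.2748/tmj.20211209, 2411.12249, 2106.03803, 2303.05030, doi:10.1017/s1474748025101291, doi:10.4171/dm/1061, doi:10.2748/tmj.20211209]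

Barriers (technique_class: lattice-rigidity, lefschetz-1-1, branch-transfer): - technique_class: lattice-rigidity, lefschetz-1-1, branch-transfer
- Literature.Barriers.KontsevichZagierPeriods.kzConjecture_implies_oddZetaAlgIndep: evaded on the
cell — no ζ-value, logarithm or non-CM transcendence statement is decided; completeness is Lefschetz
(1,1) / lattice algebra; the barrier bites only on OffCellKernel (declared, not claimed).
- Literature.Barriers.KontsevichZagierPeriods.kzConjecture_implies_twoPiI_log_algIndep: same — not
engaged by the cell.
- Literature.Barriers.KontsevichZagierPeriods.kzConjecture_implies_ellipticPeriods_algIndep: the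
cell asserts NO ℚ̄-algebraic independence of elliptic periods; it uses only ℤ-relations and proves
the chains; GPC(E×E′) (the four-term Gaussian relations) is explicitly outside the cell.
- Literature.Barriers.KontsevichZagierPeriods.noSemialgebraicPrimitive_inv_sub_two: not in the
technique class — no variable is integrated out; the moves are rule 2 along uniformised branches
(semialgebraic graphs on divided-isogeny curves) plus rules 1a/1b and Fubini products.
- Literature.Barriers.KontsevichZagierPeriods.algebraicPrimitivesObstructionNarrow: same.
- Literature.Barriers.KontsevichZagierPeriods.cressonViuSos_prop_3_2: not engaged — piecewise maps
on finitely many semialgebraic pieces, no global homeomorphism of polyhedra.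
- Literature.Barriers.KontsevichZagierPeriods.not_complete_of_undecidable: consistent — on the cell
equality is DECIDABLE by lattice arithmetic (tt′ ∈ ℚ is decided by the isogeny class / CM dat

History (route lifecycle, newest last):
- 2026-08-17T12:29:06Z · rev 1: restated Assembly (stmt-KontsevichZagierPeriods-18165) — bc6 repair + D-0019 shape: the assembly node is the cell X (five items -> X kernel-checked in the registered skeleton); closes : X -> OffCellKernel -> S (2 load (planner-plan-novel-KontsevichZagierPeriods-Kont-0a4ce36c-v2-)
- 2026-08-17T12:45:47Z · rev 3: restated TwistedSquaresCell (stmt-KontsevichZagierPeriods-18178) — bc6: make every item a load-bearing binder (cone 7/7: the 7th is the proved-now assembly implication; BC1 warn justified: one thesis, the assembly node is glue) (planner-plan-novel-KontsevichZagierPeriods-Kont-0a4ce36c-v2-)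
- 2026-08-17T12:48:15Z · rev 4: dropped stmt-KontsevichZagierPeriods-18097, stmt-KontsevichZagierPeriods-18099 — drop two malformed informal items (the CLI stored the literal '@informal_k3.txt' and the add ran twice); re-filed once with inline text as RealDoublePlaneCell (planner-plan-novel-KontsevichZagierPeriods-Kont-0a4ce36c-v2-)
- 2026-08-17T12:59:40Z · rev 5: dropped stmt-KontsevichZagierPeriods-18112 — route-repair audit (unit rbadge-KontsevichZagierPeriods-Lattice-7b219874): the needs_repair `route.declared-not-in-cone: Assembly` rests on the bc6 stamp of 12: (planner-rbadge-KontsevichZagierPeriods-Lattice-7b219874-0)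
- 2026-08-17T14:10:22Z · rev 7: dropped stmt-KontsevichZagierPeriods-18111 — route-repair (rbadge g3): DROP the informal K3-row note RealDoublePlaneCell (stmt-KontsevichZagierPeriods-18111; no Lean signature, not a binder of closes, neve (planner-rbadge-KontsevichZagierPeriods-Lattice-7b219874-g3-0)
- 2026-08-17T18:52:59Z · rev 15: dropped SummitImpliesOffCellKernel — route-repair (rbadge g5): drop the aside probe item SummitImpliesOffCellKernel (stmt-KontsevichZagierPeriods-19685) again — outcome of the test: on the current (planner-rbadge-KontsevichZagierPeriods-Lattice-7b219874-g5-0)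
- 2026-08-25T03:34:02Z · DORMANT — reconciler: no traction for 7.3 d (last activity item-evidence-added at 2026-08-17T18:57:06Z); parked, not closed — `ledger route dormant route-KontsevichZagier (operator:999:2905259)

sub-problem: KontsevichZagierPeriods · status: dormant · opened planner-plan-novel-KontsevichZagierPeriods-Kont-0a4ce36c-v2-g30-0 2026-08-17T12:21:40Z · rev 15 · ledger route-KontsevichZagierPeriods-LatticeLefschetz
GENERATED by the gate from the ledger (D-0016/17). Provers cite these decls: `theorem foo : Summit.KontsevichZagierPeriods.KontsevichZagierPeriods.Theses.LatticeLefschetz.<Decl> := …` in Summits/KontsevichZagierPeriods/KontsevichZagierPeriods/Theorems/<Name>.lean.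
-/

namespace Summit.KontsevichZagierPeriods.KontsevichZagierPeriods.Theses.LatticeLefschetz

open scoped BigOperators Topology Manifold Classical MeasureTheory ProbabilityTheory Matrix InnerProductSpace ComplexConjugate ContinuousMap
open Filter Set Function TopologicalSpace MeasureTheory

attribute [summit_statement] _root_.KontsevichZagierPeriods

open Literature Periods

/-- item stmt-KontsevichZagierPeriods-18159 · crux · rank 2 · open · by planner
why it might fail: Settled positively in evidence only (TwistTransferProof.lean, rc 0/0 sorry: k from IsReal.exists_eq_int_mul, mu algebraic by isAlgebraic_of_mul_mem_lattice, chain via the closed sibling AlgebraicModuliRealPeriodCell); risk until landed: k-piece images over R_alg must cover {P2>0} up to null sets.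
sources: SilvermanAEC2009, Lawden1989, KontsevichZagier2001, Summit.KontsevichZagierPeriods.IsogenyCertificates.RealPeriodSectorCompleteLine.RealPeriodSectorComplete_of
[crux] TWIST TRANSFER — for two real period lattices Λ₁, Λ₂ of cubics x³+Aᵢx+Bᵢ (three real roots)
and a real μ > 0 with μΛ₁ ⊆ Λ₂: μΩ₀(Λ₁) = kΩ₀(Λ₂) for a positive integer k, μ is algebraic, and for
every positive rational q the representations [{P₁>0}, (qμ/k)/√P₁] and [{P₂>0}, q/√P₂] are
KZ-equivalent (the uniformised-branch transfer of IsogenyCertificates with a LATTICE INCLUSION as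
hypothesis instead of Schneider, and an algebraic — not rational — scaling). [difficulty: L] -/
@[route_item "route-KontsevichZagierPeriods-LatticeLefschetz", crux]
def TwistTransfer : Prop :=
  ∀ (A₁ B₁ A₂ B₂ : ℤ), 4 * A₁ ^ 3 + 27 * B₁ ^ 2 < 0 → 4 * A₂ ^ 3 + 27 * B₂ ^ 2 < 0 → ∀ (L₁ L₂ : PeriodPair), L₁.IsReal → L₂.IsReal → L₁.g₂ = -4 * (A₁ : ℂ) → L₁.g₃ = -4 * (B₁ : ℂ) → L₂.g₂ = -4 * (A₂ : ℂ) → L₂.g₃ = -4 * (B₂ : ℂ) → ∀ (μ : ℝ), 0 < μ → (∀ z ∈ L₁.lattice, (μ : ℂ) * z ∈ L₂.lattice) → ∃ k : ℕ, 0 < k ∧ μ * L₁.minRealPeriod = (k : ℝ) * L₂.minRealPeriod ∧ IsAlgebraic ℚ μ ∧ ∀ (q : ℚ), 0 < q → ∀ (s₁ s₂ : Literature.NumberTheory.Transcendental.KZ.IntegralRep 1), s₁.domain = {x | 0 < x 0 ^ 3 + (A₁ : ℝ) * x 0 + (B₁ : ℝ)} → Set.EqOn s₁.integrand (fun x =>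 (q : ℝ) * μ / (k : ℝ) / Real.sqrt (x 0 ^ 3 + (A₁ : ℝ) * x 0 + (B₁ : ℝ))) s₁.domain → s₂.domain = {x | 0 < x 0 ^ 3 + (A₂ : ℝ) * x 0 + (B₂ : ℝ)} → Set.EqOn s₂.integrand (fun x => (q : ℝ) / Real.sqrt (x 0 ^ 3 + (A₂ : ℝ) * x 0 + (B₂ : ℝ))) s₂.domain → Literature.NumberTheory.Transcendental.KZ.Equivalent s₁ s₂

/-- item stmt-KontsevichZagierPeriods-18160 · crux · rank 3 · open · by planner
why it might fail: Declared summit-equivalent RESIDUAL, not claimed: S -> OffCellKernel and S <-> Cell /\ OffCellKernel are kernel-checked (refuter evidence OffCellKernelAttack.lean); false iff Conjecture 1 fails; the barriers kzConjecture_implies_* bite here in full. Not a prover target.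
sources: KontsevichZagier2001, HuberMullerStachPeriods2017, Ayoub2014
[crux] DECLARED REMAINDER, NOT CLAIMED easier than the Statement: Conjecture 1 in kernel form for
the calculus enlarged by the twisted-squares relators (every value-0 formal ℤ-combination lies in
KZ.relations ⊔ closure of the cell's pair differences). Summit-implied; equivalent to the kernel
conjecture modulo the cell. [deps: TwistTransfer] [difficulty: open-problem] -/
@[route_item "route-KontsevichZagierPeriods-LatticeLefschetz", crux]
def OffCellKernel : Prop :=
  ∀ c : Literature.NumberTheory.Transcendental.KZ.FormalRep, Literature.NumberTheory.Transcendental.KZ.eval c = 0 → c ∈ Literature.NumberTheory.Transcendental.KZ.relations ⊔ AddSubgroup.closure {d : Literature.NumberTheory.Transcendental.KZ.FormalRep | ∃ (A B A' B' : ℤ) (a b : ℚ) (r r' : Literature.NumberTheory.Transcendental.KZ.IntegralRep 2), 4 * A ^ 3 + 27 * B ^ 2 < 0 ∧ 4 * A' ^ 3 + 27 * B' ^ 2 < 0 ∧ 0 < a ∧ 0 < b ∧ r.domain = {x | 0 < x 0 ^ 3 + (A : ℝ) * x 0 + (B : ℝ) ∧ 0 < x 1 ^ 3 + (A' : ℝ)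 * x 1 + (B' : ℝ)} ∧ Set.EqOn r.integrand (fun x => (a : ℝ) / (Real.sqrt (x 0 ^ 3 + (A : ℝ) * x 0 + (B : ℝ)) * Real.sqrt (x 1 ^ 3 + (A' : ℝ) * x 1 + (B' : ℝ)))) r.domain ∧ r'.domain = {x | 0 < x 0 ^ 3 + (A : ℝ) * x 0 - (B : ℝ) ∧ 0 < x 1 ^ 3 + (A' : ℝ) * x 1 - (B' : ℝ)} ∧ Set.EqOn r'.integrand (fun x => (b : ℝ) / (Real.sqrt (x 0 ^ 3 + (A : ℝ) * x 0 - (B : ℝ)) * Real.sqrt (x 1 ^ 3 + (A' : ℝ) * x 1 - (B' : ℝ)))) r'.domain ∧ r.value = r'.value ∧ d = Literature.NumberTheory.Transcendental.KZ.of r - Literature.NumberTheory.Transcendental.KZ.of r'}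

/-- item stmt-KontsevichZagierPeriods-18161 · support · rank 9 · open · by planner
sources: Lawden1989, SilvermanAEC2009
[support] LATTICE RIGIDITY (the transcendence-free completeness input): for real lattices Λ, Λ′ with
g₂³ − 27g₃² > 0 (rectangular), a·Ω₀(Λ)Ω₀(Λ′) = b·Ω₀(iΛ)Ω₀(iΛ′) with a, b positive rationals forces a
real μ > 0 with μ·iΛ ⊆ Λ′ and μ·Λ ⊆ iΛ′ (τ′ = −(m/n)/τ; μ = nΩ₀(iΛ′)/Ω₀(Λ)). [difficulty:
provable-now] -/
@[route_item "route-KontsevichZagierPeriods-LatticeLefschetz", crux]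
def LatticeRigidity : Prop :=
  ∀ (L L' : PeriodPair), L.IsReal → L'.IsReal → 0 < L.g₂.re ^ 3 - 27 * L.g₃.re ^ 2 → 0 < L'.g₂.re ^ 3 - 27 * L'.g₃.re ^ 2 → ∀ (a b : ℚ), 0 < a → 0 < b → (a : ℝ) * (L.minRealPeriod * L'.minRealPeriod) = (b : ℝ) * ((L.mulLeft Complex.I Complex.I_ne_zero).minRealPeriod * (L'.mulLeft Complex.I Complex.I_ne_zero).minRealPeriod) → ∃ μ : ℝ, 0 < μ ∧ (∀ z ∈ (L.mulLeft Complex.I Complex.I_ne_zero).lattice, (μ : ℂ) * z ∈ L'.lattice) ∧ (∀ z ∈ L.lattice, (μ : ℂ) * z ∈ (L'.mulLeft Complex.I Complex.I_ne_zero).lattice)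

/-- item stmt-KontsevichZagierPeriods-18162 · support · rank 9 · open · by planner
sources: Lawden1989, SilvermanAEC2009
[support] the real period lattice of y² = x³+Ax+B (4A³+27B² < 0): a real PeriodPair with g₂ = −4A,
g₃ = −4B and positive discriminant, and existence of the 1-dim representations [{P>0}, c/√P],
[{P⁻>0}, c/√P⁻] for real-algebraic c > 0 (tree: Uniformization, RealLatticePeriod,
IsogenyCertificates rep constructions). [difficulty: provable-now] -/
@[route_item "route-KontsevichZagierPeriods-LatticeLefschetz", crux]
def TwistPeriodLattices : Prop :=
  ∀ (A B : ℤ), 4 * A ^ 3 + 27 * B ^ 2 < 0 → ∃ L : PeriodPair, L.IsReal ∧ L.g₂ = -4 * (A : ℂ) ∧ L.g₃ = -4 * (B : ℂ) ∧ 0 < L.g₂.re ^ 3 - 27 * L.g₃.re ^ 2 ∧ (∀ c : ℝ, IsAlgebraic ℚ c → 0 < c → ∃ s : Literature.NumberTheory.Transcendental.KZ.IntegralRep 1, s.domain = {x | 0 < x 0 ^ 3 + (A : ℝ) * x 0 + (B : ℝ)} ∧ Set.EqOn s.integrand (fun x => c / Real.sqrt (x 0 ^ 3 + (A : ℝ)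 * x 0 + (B : ℝ))) s.domain) ∧ (∀ c : ℝ, IsAlgebraic ℚ c → 0 < c → ∃ s : Literature.NumberTheory.Transcendental.KZ.IntegralRep 1, s.domain = {x | 0 < x 0 ^ 3 + (A : ℝ) * x 0 - (B : ℝ)} ∧ Set.EqOn s.integrand (fun x => c / Real.sqrt (x 0 ^ 3 + (A : ℝ) * x 0 - (B : ℝ))) s.domain)

/-- item stmt-KontsevichZagierPeriods-18163 · support · rank 9 · open · by planner
sources: Lawden1989, KontsevichZagier2001
[support] Fubini + the real-period formula: a product representation of the cell has value
a·(2Ω₀)(2Ω₀′) (tree `IntegralRep.value_prod`, `IsReal.realPeriod_formula_holds`). [difficulty: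
provable-now] -/
@[route_item "route-KontsevichZagierPeriods-LatticeLefschetz", crux]
def ProductValues : Prop :=
  ∀ (A B A' B' : ℤ), 4 * A ^ 3 + 27 * B ^ 2 < 0 → 4 * A' ^ 3 + 27 * B' ^ 2 < 0 → ∀ (L L' : PeriodPair), L.IsReal → L'.IsReal → L.g₂ = -4 * (A : ℂ) → L.g₃ = -4 * (B : ℂ) → L'.g₂ = -4 * (A' : ℂ) → L'.g₃ = -4 * (B' : ℂ) → ∀ (a : ℚ) (r : Literature.NumberTheory.Transcendental.KZ.IntegralRep 2), r.domain = {x | 0 < x 0 ^ 3 + (A : ℝ) * x 0 + (B : ℝ) ∧ 0 < x 1 ^ 3 + (A' : ℝ) * x 1 + (B' : ℝ)} → Set.EqOn r.integrand (fun x => (a : ℝ) / (Real.sqrt (x 0 ^ 3 + (A : ℝ) * x 0 + (B : ℝ)) * Real.sqrt (x 1 ^ 3 + (A' : ℝ) * x 1 + (B' : ℝ)))) r.domain → r.value = (a : ℝ) * ((2 * L.minRealPeriod) * (2 * L'.minRealPeriod))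

/-- item stmt-KontsevichZagierPeriods-18164 · support · rank 9 · open · by planner
sources: KontsevichZagier2001
[support] calculus algebra: a product representation equals the Fubini product of its factors,
`Equivalent.prod` and the factor swap `mul_sub_mul_comm_mem_relations` turn two 1-dim equivalences
with ONE common scaling into the cell's equivalence (tree KZProductIdeal). [difficulty:
provable-now] -/
@[route_item "route-KontsevichZagierPeriods-LatticeLefschetz", crux]
def ProductBookkeeping : Prop :=
  ∀ (A B A' B' : ℤ) (a b : ℚ) (c : ℝ) (r r' : Literature.NumberTheory.Transcendental.KZ.IntegralRep 2) (s t u₁ u₂ w₁ w₂ : Literature.NumberTheory.Transcendental.KZ.IntegralRep 1), r.domain = {x | 0 < x 0 ^ 3 + (A : ℝ) * x 0 + (B : ℝ) ∧ 0 < x 1 ^ 3 + (A' : ℝ) * x 1 + (B' : ℝ)} → Set.EqOn r.integrand (fun x => (a : ℝ) / (Real.sqrt (x 0 ^ 3 + (A : ℝ) * x 0 + (B : ℝ)) * Real.sqrt (x 1 ^ 3 + (A' : ℝ) * x 1 + (B' : ℝ)))) r.domain → r'.domain = {x | 0 < x 0 ^ 3 + (A : ℝ) * x 0 - (B : ℝ)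 ∧ 0 < x 1 ^ 3 + (A' : ℝ) * x 1 - (B' : ℝ)} → Set.EqOn r'.integrand (fun x => (b : ℝ) / (Real.sqrt (x 0 ^ 3 + (A : ℝ) * x 0 - (B : ℝ)) * Real.sqrt (x 1 ^ 3 + (A' : ℝ) * x 1 - (B' : ℝ)))) r'.domain → s.domain = {x | 0 < x 0 ^ 3 + (A : ℝ) * x 0 + (B : ℝ)} → Set.EqOn s.integrand (fun x => 1 / Real.sqrt (x 0 ^ 3 + (A : ℝ) * x 0 + (B : ℝ))) s.domain → t.domain = {x | 0 < x 0 ^ 3 + (A : ℝ) * x 0 - (B : ℝ)} → Set.EqOn t.integrand (fun x => 1 / Real.sqrt (x 0 ^ 3 + (A : ℝ) * x 0 - (B : ℝ))) t.domain → u₁.domain = {x | 0 < x 0 ^ 3 + (A' : ℝ) * x 0 + (B' : ℝ)} → Set.EqOn u₁.integrand (fun x => (a : ℝ) / Real.sqrt (x 0 ^ 3 + (A' : ℝ) * x 0 + (B' : ℝ))) u₁.domain → u₂.domain = {x | 0 < x 0 ^ 3 + (A : ℝ) * x 0 - (B : ℝ)} → Set.EqOn u₂.integrand (fun x => c / Real.sqrt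 (x 0 ^ 3 + (A : ℝ) * x 0 - (B : ℝ))) u₂.domain → w₁.domain = {x | 0 < x 0 ^ 3 + (A' : ℝ) * x 0 - (B' : ℝ)} → Set.EqOn w₁.integrand (fun x => (b : ℝ) / Real.sqrt (x 0 ^ 3 + (A' : ℝ) * x 0 - (B' : ℝ))) w₁.domain → w₂.domain = {x | 0 < x 0 ^ 3 + (A : ℝ) * x 0 + (B : ℝ)} → Set.EqOn w₂.integrand (fun x => c / Real.sqrt (x 0 ^ 3 + (A : ℝ) * x 0 + (B : ℝ))) w₂.domain → Literature.NumberTheory.Transcendental.KZ.Equivalent u₂ u₁ → Literature.NumberTheory.Transcendental.KZ.Equivalent w₂ w₁ → Literature.NumberTheory.Transcendental.KZ.Equivalent r r'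

/-- item stmt-KontsevichZagierPeriods-18109 · assembly · rank 1 · open · by planner
sources: KontsevichZagier2001
[assembly] CELL ASSEMBLY: the five engine items imply THE TWISTED-SQUARES CELL (conclusion written
out: for A B A' B' in Z with 4A^3+27B^2<0, 4A'^3+27B'^2<0 and positive rationals a b, the two
product representations of the cell with equal values are KZ-equivalent). PROVED sorry-free by the
planner (evidence bc/CellAssembly_pub.lean, theorem TwistedSquaresCell_of : TwistedSquaresCellOfSig,
rc 0) — a prover lands it verbatim as Theorems/LatticeLefschetzCellAssembly.lean. All seven items
are load-bearing binders of closes. -/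
@[route_item "route-KontsevichZagierPeriods-LatticeLefschetz", crux]
def CellAssembly : Prop :=
  TwistPeriodLattices → ProductValues → LatticeRigidity → TwistTransfer → ProductBookkeeping → (∀ (A B A' B' : ℤ), 4 * A ^ 3 + 27 * B ^ 2 < 0 → 4 * A' ^ 3 + 27 * B' ^ 2 < 0 → ∀ (a b : ℚ), 0 < a → 0 < b → ∀ (r r' : Literature.NumberTheory.Transcendental.KZ.IntegralRep 2), r.domain = {x | 0 < x 0 ^ 3 + (A : ℝ) * x 0 + (B : ℝ) ∧ 0 < x 1 ^ 3 + (A' : ℝ) * x 1 + (B' : ℝ)} → Set.EqOn r.integrand (fun x => (a : ℝ) / (Real.sqrt (x 0 ^ 3 + (A : ℝ) * x 0 + (B : ℝ)) * Real.sqrt (x 1 ^ 3 + (A' : ℝ) * x 1 + (B' : ℝ)))) r.domain → r'.domain = {x | 0 < x 0 ^ 3 + (A : ℝ) * x 0 - (B : ℝ) ∧ 0 < x 1 ^ 3 + (A' : ℝ) * x 1 - (B' : ℝ)} → Set.EqOn r'.integrand (fun x => (b : ℝ) / (Real.sqrt (x 0 ^ 3 + (A : ℝ) * x 0 - (B : ℝ))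 * Real.sqrt (x 1 ^ 3 + (A' : ℝ) * x 1 - (B' : ℝ)))) r'.domain → r.value = r'.value → Literature.NumberTheory.Transcendental.KZ.Equivalent r r')

-- records of items no longer active in this route (dropped / restated):
-- earlier Assembly (stmt-KontsevichZagierPeriods-18165, replaced 2026-08-17T12:29:06Z -> stmt-KontsevichZagierPeriods-18178): retired by None — Summit.KontsevichZagierPeriods.KontsevichZagierPeriods.Theses.LatticeLefschetz.TwistPeriodLattices → Summit.KontsevichZagierPeriods.KontsevichZagierPeriods.Theses.LatticeLefschetz.ProductValues → Summit.KontsevichZagierPeriods.KontsevichZagierPeriods.Theses.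
-- earlier TwistedSquaresCell (stmt-KontsevichZagierPeriods-18178, replaced 2026-08-17T12:45:47Z -> stmt-KontsevichZagierPeriods-18109): retired by None — ∀ (A B A' B' : ℤ), 4 * A ^ 3 + 27 * B ^ 2 < 0 → 4 * A' ^ 3 + 27 * B' ^ 2 < 0 → ∀ (a b : ℚ), 0 < a → 0 < b → ∀ (r r' : Literature.NumberTheory.Transcendental.KZ.IntegralRep 2), r.domain = {x | 0 < x 0 ^ 3 + (A : ℝ) * x 0 + (B : ℝ) ∧ 0 < x 1 ^ 3 + (A

/-! D-0027 §2.1 — DECIDING THEOREM (planner-authored via `route open/edit --closes-file`; by planner-rbadge-KontsevichZagierPeriods-Lattice-7b219874-g4-0 2026-08-17T18:14:52Z):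
its hypotheses are this route's items and its conclusion the sub-problem Statement (glue_lint), and it elaborates with this file. -/

@[closes "route-KontsevichZagierPeriods-LatticeLefschetz"] theorem closes (hCell : CellAssembly) (hLat : TwistPeriodLattices) (hVal : ProductValues)
    (hRig : LatticeRigidity) (hTw : TwistTransfer) (hBook : ProductBookkeeping)
    (hKer : OffCellKernel) : _root_.KontsevichZagierPeriods := by
  -- ENGINE (the five provable-now items) ⟹ the twisted-squares cell, via the assembly item
  have hT := hCell hLat hVal hRig hTw hBook
  intro n m r r' _ _ hv
  -- a value-0 difference of representations evaluates to 0 in the formal group …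
  have h0 : Literature.NumberTheory.Transcendental.KZ.eval
      (Literature.NumberTheory.Transcendental.KZ.of r - Literature.NumberTheory.Transcendental.KZ.of r') = 0 := by
    simp [Literature.NumberTheory.Transcendental.KZ.eval_of, hv]
  -- … so it lies in relations ⊔ closure(cell differences) (OffCellKernel), and every adjoined
  -- cell difference is discharged by the cell
  refine sup_le le_rfl ((AddSubgroup.closure_le _).mpr ?_) (hKer _ h0)
  rintro d ⟨A, B, A', B', a, b, ρ, ρ', hA0, hA', ha, hb, hd, hi, hd', hi', hval, rfl⟩
  exact hT A B A' B' hA0 hA' a b ha hb ρ ρ' hd hi hd' hi' hval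

end Summit.KontsevichZagierPeriods.KontsevichZagierPeriods.Theses.LatticeLefschetz
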